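import Mathlib
import HarnessLib
import Summits.ValiantsHypothesis.ValiantsHypothesis.Theses.MonotoneRestoration
import Literature.Computability.AlgebraicComplexity.ArithCircuit
import Literature.Computability.AlgebraicComplexity.ArithCircuitProofs
import Literature.Computability.AlgebraicComplexity.MonotoneStructure
import Literature.Computability.AlgebraicComplexity.PermanentIrreducible
import Literature.ModelTheory.FiniteModelTheory.CkEquiv
import Summits.ValiantsHypothesis.ValiantsHypothesis.Theorems.MonotoneRestorationMonotoneRestorationQPCosetCount
import Summits.ValiantsHypothesis.ValiantsHypothesis.Theorems.MonotoneRestorationMonotoneRestorationQPSymmetricLB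
import Summits.ValiantsHypothesis.ValiantsHypothesis.Theorems.MonotoneRestorationMonotoneRestorationQPSupportSymmetrisation
import Summits.ValiantsHypothesis.ValiantsHypothesis.Theorems.MonotoneRestorationMonotoneRestorationQPSparseRegime
import Summits.ValiantsHypothesis.ValiantsHypothesis.Theorems.MonotoneRestorationMonotoneRestorationQPBeta
import Literature.Computability.AlgebraicComplexity.SymmetricArithCircuit
import Literature.Computability.AlgebraicComplexity.DawarWilsenach2025Proofs
import Literature.GroupTheory.PermutationGroups.SmallIndexSubgroups
import Summits.ValiantsHypothesis.ValiantsHypothesis.Theorems.MonotoneRestorationQP.Negative.LoadBearing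
import Summits.ValiantsHypothesis.ValiantsHypothesis.Theorems.MonotoneRestorationMonotoneRestorationQPPermSupportCount
import Summits.ValiantsHypothesis.ValiantsHypothesis.Theorems.MonotoneRestorationMonotoneRestorationQPMulGateChildren

/-! TTRL-lite variant V14551 of stmt-ValiantsHypothesis-15886 -/

-- `ValiantsHypothesis.ValiantsHypothesis`: the D-0017 layout repeats the problem name in the path.
set_option linter.dupNamespace false

namespace Summit.ValiantsHypothesis.ValiantsHypothesis.Theorems

open Summit.ValiantsHypothesis.ValiantsHypothesis.Theses.MonotoneRestoration
open Literature.Computability.AlgebraicComplexity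

/-- TTRL-lite variant V14551 (`n := 8`, gate type `G := Fin 3`) of `stub_mulGate_children_extend`:
over `ℝ≥0` there is no cancellation, so if `P` is a nonzero `×`-gate whose support translates
into `f.support` by a common shift `μ`, then (1) the support of every child `h` of `P` translates
into `f.support` too (shift by `μ` plus a fixed monomial of the product of the other children),
and (2) for two distinct children `h ≠ h'`, every sum of a monomial of `eval h` and a monomial of
`eval h'` extends to a monomial of `f`. Immediate specialisation of the landed general lemma
`Summit.ValiantsHypothesis.ValiantsHypothesis.Theorems.stub_mulGate_children_extend`. [folklore] -/
theorem stub_mulGate_children_extend_var14551 :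
    ∀ (C : LabelledArithCircuit NNReal (Fin 8 × Fin 8) Unit (Fin 3))
      (f : MvPolynomial (Fin 8 × Fin 8) NNReal) (P : Fin 3) (hP : C.label P = .mul)
      (hP0 : C.eval P ≠ 0)
      (hext : ∃ μ : (Fin 8 × Fin 8) →₀ ℕ, ∀ m ∈ (C.eval P).support, m + μ ∈ f.support),
      (∀ h ∈ C.children P, ∃ μ : (Fin 8 × Fin 8) →₀ ℕ, ∀ m ∈ (C.eval h).support,
          m + μ ∈ f.support) ∧
      (∀ h ∈ C.children P, ∀ h' ∈ C.children P, h ≠ h' → ∀ m ∈ (C.eval h).support,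
          ∀ m' ∈ (C.eval h').support, ∃ μ : (Fin 8 × Fin 8) →₀ ℕ, m + m' + μ ∈ f.support) :=
  fun C f _P hP hP0 hext =>
    Summit.ValiantsHypothesis.ValiantsHypothesis.Theorems.stub_mulGate_children_extend C f hP hP0 hext

end Summit.ValiantsHypothesis.ValiantsHypothesis.Theorems
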